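import Literature.Barriers.CriticalPhenomena.FiniteRangeDecompositionPairAsymptotics
import Literature.Barriers.CriticalPhenomena.WeaklySAWPerturbativeBetaBounds
import HarnessLib

/-!
# BBS 2015, §6.1 / Assumption (A1) at the critical point: the limit `lim_{j→∞}β_j(m² = 0)` of the
# perturbative coefficients of the 4-dimensional weakly self-avoiding walk exists and is positive

Sequel of `WeaklySAWPerturbativeBeta.lean` / `WeaklySAWPerturbativeBetaBounds.lean` (the sequence
`β_j = 8Σ_x(w_{j+1,x}² - w_{j,x}²)`, `w_j = Σ_{i=1}^jC_i`, of Bauerschmidt–Brydges–Slade, CMP 337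
(2015), arXiv:1403.7422 [BBS2015], §6.1, for the explicit finite-range decomposition
`C_i = LongRangePhi4.FRD.Gam d L m² i`, its continuity in `m²` including `m² = 0`, `β_j(m²) ≥ 0`, and the
first clause of (A1), `sup_j|β_j| < ∞`, at `d = 4`) and of
`FiniteRangeDecompositionPairAsymptotics.lean` (the scaling limits `J_l = ∫G_L(y,0)G_L(y/L^l,0)dy ≥ 0`,
`J_0 > 0`, of the lattice pair sums `Σ_xΓ_k(x;0)Γ_{k+l}(x;0)`). §6.1 of [BBS2015]: "Moreover, it is
shown in [BBS-rg-pt] that `lim_{j→∞}β_j` [exists] for `m² = 0`, so `β_j` is bounded away from `0` for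
sufficiently large `j`. … **Assumption (A1).** The sequence `(β_j)` is bounded … There exists `c > 0`
such that `β_j ≥ c` for all but `c⁻¹` values of `j ≤ j_Ω`" (at `m² = 0`, `j_Ω = ∞`); and §5.1:
"the value `m² = 0` corresponds to `ν = ν_c`".

At `d = 4` and `m² = 0` the coefficient is a sum of lattice pair sums,
`β_j = 8[(Γ_{j+1},Γ_{j+1}) + 2Σ_{i=1}^{j}(Γ_i,Γ_{j+1})]`, `(Γ_a,Γ_b) = Σ_xΓ_a(x;0)Γ_b(x;0)`, whose
scaling limits (`FRD.sum_Gam_mul_Gam_asymp`, with the prefactor `L^{-2(j+1-i)}` INDEPENDENT of the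
scale — the marginality of `d = 4`) give `β_j = 8[J_0 + 2Σ_{l=1}^{j-1}L^{-2l}J_l] + O(jL^{-j})`, hence

  `lim_{j→∞} β_j(0) = b̄_L := 8[J_0 + 2Σ_{l≥1}L^{-2l}J_l] ≥ 8J_0 > 0`.

(Since `Σ_{j<N}β_j = 8Σ_xw_N(x)²` grows like `N log L/π²` — the logarithmic divergence of the bubble in
`d = 4` — the limit is the universal `log L/π²` of [BBS-rg-pt]; only its existence and positivity,
which is what (A1) requires, are established here.)

## What this file proves (everything; two definitions, no named fact)

* `betaPT_zero_eq_pairSums` — `β_j(0) = 8[(Γ_{j+1},Γ_{j+1}) + 2Σ_{i<j}(Γ_{i+1},Γ_{j+1})]`;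
* `abs_pairSum_top_sub_le` (`|(Γ_{j+1},Γ_{j+1}) - J_0| ≤ C/L^{j+1}`), `abs_pairSum_mid_sub_le`
  (`|(Γ_{i+1},Γ_{j+1}) - L^{-2(j-i)}J_{j-i}| ≤ CL^{-2(j-i)}/L^{i+1}`, `1 ≤ i < j`), `abs_pairSum_one_le`
  (`|(Γ_1,Γ_{j+1})| ≤ 16c²L⁴/L^{2j}`);
* `betaApprox` (`b̄_j = 8[J_0 + 2Σ_{l=1}^{j-1}L^{-2l}J_l]`), **`abs_betaPT_zero_sub_betaApprox_le`** —
  `|β_j(0) - b̄_j| ≤ K(j+1)L^{-j}`;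
* `betaLim` (`b̄_L`), `summable_innerG0_geometric`, `tendsto_betaApprox`, **`betaLim_pos`**,
  **`tendsto_betaPT_zero`** — **`β_j(0) → b̄_L > 0` as `j → ∞`**, and
  **`BBS2015_A1_critical`** — the second clause of (A1) at `m² = 0`: `β_j(0) ≥ ½b̄_L > 0` for all
  `j ≥ j₀` (all `L ≥ 2`).
-/

noncomputable section

open MeasureTheory Filter Topology Finset
open Literature.Probability.LatticeModels
open scoped BigOperators Real

namespace Literature.Barriers.CriticalPhenomena

namespace CTWSAW

open LongRangePhi4 LongRangePhi4.FRD

/-! ### `β_j(0)` as a sum of lattice pair sums -/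

/-- **`β_j(0) = 8[(Γ_{j+1},Γ_{j+1}) + 2Σ_{i<j}(Γ_{i+1},Γ_{j+1})]`** with
`(Γ_a,Γ_b) = Σ_{|x|₁<½L^{j+1}}Γ_a(x;0)Γ_b(x;0)` (`w_{j+1}² - w_j² = Γ_{j+1}(Γ_{j+1} + 2w_j)`,
`w_j = Σ_{i<j}Γ_{i+1}`). [cite: BauerschmidtBrydgesSlade2015LogCorr, §6.1 (definition of β_j and w_j)] -/
theorem betaPT_zero_eq_pairSums {L : ℝ} (hL : 1 ≤ L) (j : ℕ) :
    betaPT 4 L 0 j = 8 * ((∑ x ∈ PT.ball (L ^ (j + 1) / 2), Gam 4 L 0 (j + 1) x * Gam 4 L 0 (j + 1) x) +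
      2 * ∑ i ∈ range j, ∑ x ∈ PT.ball (L ^ (j + 1) / 2), Gam 4 L 0 (i + 1) x * Gam 4 L 0 (j + 1) x) := by
  rw [betaPT_eq_sum (by norm_num) hL le_rfl j]
  congr 1
  have hx : ∀ x : Site 4, covSum 4 L 0 (j + 1) x ^ 2 - covSum 4 L 0 j x ^ 2 =
      Gam 4 L 0 (j + 1) x * Gam 4 L 0 (j + 1) x +
        2 * ∑ i ∈ range j, Gam 4 L 0 (i + 1) x * Gam 4 L 0 (j + 1) x := by
    intro x
    rw [covSum_succ]
    have e : ∑ i ∈ range j, Gam 4 L 0 (i + 1) x * Gam 4 L 0 (j + 1) x =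
        covSum 4 L 0 j x * Gam 4 L 0 (j + 1) x := by
      unfold covSum; rw [Finset.sum_mul]
    rw [e]
    ring
  rw [Finset.sum_congr rfl fun x _ => hx x, Finset.sum_add_distrib, ← Finset.mul_sum, Finset.sum_comm]

/-! ### The three kinds of pair sums -/

/-- The top pair sum: **`|(Γ_{j+1},Γ_{j+1}) - J_0| ≤ C/L^{j+1}`** (`j ≥ 1`; the prefactor is `1` at
`d = 4`). [cite: Slade2017, Lemma 5.2.2 (proof, §10.4, display (10.45) with l = 0)] -/
theorem abs_pairSum_top_sub_le {L : ℝ} (hL : 2 ≤ L) {C : ℝ}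
    (hA : ∀ k : ℕ, 2 ≤ k → ∀ l : ℕ,
      |∑ x ∈ PT.ball (L ^ k / 2), Gam 4 L 0 k x * Gam 4 L 0 (k + l) x -
        ((L ^ k) ^ 2 / (L ^ k) ^ 4) * ((L ^ (k + l)) ^ 2 / (L ^ (k + l)) ^ 4) * (L ^ k) ^ 4 *
          innerG0 4 L l| ≤
        C * (((L ^ k) ^ 2 / (L ^ k) ^ 4) * ((L ^ (k + l)) ^ 2 / (L ^ (k + l)) ^ 4) * (L ^ k) ^ 4) *
          (L ^ k)⁻¹)
    {j : ℕ} (hj : 1 ≤ j) :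
    |∑ x ∈ PT.ball (L ^ (j + 1) / 2), Gam 4 L 0 (j + 1) x * Gam 4 L 0 (j + 1) x - innerG0 4 L 0| ≤
      C * (L ^ (j + 1))⁻¹ := by
  have hL0 : (0 : ℝ) < L := by linarith
  have h := hA (j + 1) (by omega) 0
  have hP : ((L ^ (j + 1)) ^ 2 / (L ^ (j + 1)) ^ 4) * ((L ^ (j + 1 + 0)) ^ 2 / (L ^ (j + 1 + 0)) ^ 4) *
      (L ^ (j + 1)) ^ 4 = 1 := by
    rw [add_zero]
    have : (L ^ (j + 1)) ≠ 0 := pow_ne_zero _ hL0.ne'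
    field_simp
  rw [hP] at h
  simpa [add_zero] using h

/-- The middle pair sums: **`|(Γ_{i+1},Γ_{j+1}) - L^{-2(j-i)}J_{j-i}| ≤ CL^{-2(j-i)}/L^{i+1}`** for
`1 ≤ i < j` (the prefactor `(L^{i+1})²/(L^{j+1})² = L^{-2(j-i)}` at `d = 4`; the sum may be taken over
the larger ball `|x|₁ < ½L^{j+1}`, off the range of `Γ_{i+1}` the terms vanish).
[cite: Slade2017, Lemma 5.2.2 (proof, §10.4, display (10.45))] -/
theorem abs_pairSum_mid_sub_le {L : ℝ} (hL : 2 ≤ L) {C : ℝ}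
    (hA : ∀ k : ℕ, 2 ≤ k → ∀ l : ℕ,
      |∑ x ∈ PT.ball (L ^ k / 2), Gam 4 L 0 k x * Gam 4 L 0 (k + l) x -
        ((L ^ k) ^ 2 / (L ^ k) ^ 4) * ((L ^ (k + l)) ^ 2 / (L ^ (k + l)) ^ 4) * (L ^ k) ^ 4 *
          innerG0 4 L l| ≤
        C * (((L ^ k) ^ 2 / (L ^ k) ^ 4) * ((L ^ (k + l)) ^ 2 / (L ^ (k + l)) ^ 4) * (L ^ k) ^ 4) *
          (L ^ k)⁻¹)
    {i j : ℕ} (hi : 1 ≤ i) (hij : i < j) :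
    |∑ x ∈ PT.ball (L ^ (j + 1) / 2), Gam 4 L 0 (i + 1) x * Gam 4 L 0 (j + 1) x -
        (1 / L ^ 2) ^ (j - i) * innerG0 4 L (j - i)| ≤
      C * (1 / L ^ 2) ^ (j - i) * (L ^ (i + 1))⁻¹ := by
  have hL0 : (0 : ℝ) < L := by linarith
  have hL1 : (1 : ℝ) ≤ L := by linarith
  have h := hA (i + 1) (by omega) (j - i)
  have hidx : i + 1 + (j - i) = j + 1 := by omega
  rw [hidx] at h
  -- the prefactor at `d = 4`
  have hP : ((L ^ (i + 1)) ^ 2 / (L ^ (i + 1)) ^ 4) * ((L ^ (j + 1)) ^ 2 / (L ^ (j + 1)) ^ 4) *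
      (L ^ (i + 1)) ^ 4 = (1 / L ^ 2) ^ (j - i) := by
    have hsplit : L ^ (j + 1) = L ^ (i + 1) * L ^ (j - i) := by rw [← pow_add, hidx]
    rw [hsplit]
    have h1 : L ^ (i + 1) ≠ 0 := pow_ne_zero _ hL0.ne'
    have h2 : L ^ (j - i) ≠ 0 := pow_ne_zero _ hL0.ne'
    have hR : (1 / L ^ 2) ^ (j - i) = 1 / (L ^ (j - i)) ^ 2 := by
      rw [div_pow, one_pow, ← pow_mul, ← pow_mul, Nat.mul_comm]
    rw [hR]
    field_simp
  rw [hP] at h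
  -- enlarge the ball
  have hsub : ∑ x ∈ PT.ball (L ^ (j + 1) / 2), Gam 4 L 0 (i + 1) x * Gam 4 L 0 (j + 1) x =
      ∑ x ∈ PT.ball (L ^ (i + 1) / 2), Gam 4 L 0 (i + 1) x * Gam 4 L 0 (j + 1) x := by
    symm
    refine Finset.sum_subset (fun x hx => PT.mem_ball.2 (lt_of_lt_of_le (PT.mem_ball.1 hx) ?_))
      fun x _ hx => ?_
    · have : L ^ (i + 1) ≤ L ^ (j + 1) := pow_le_pow_right₀ hL1 (by omega)
      linarith
    · rw [PT.mem_ball, not_lt] at hx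
      rw [Gam_eq_zero (by norm_num) hL0.le le_rfl (i + 1) x hx, zero_mul]
  rw [hsub]
  exact h

/-- The bottom pair sum: **`|(Γ_1,Γ_{j+1})| ≤ 16c²L⁴/L^{2j}`** (`Γ_1` is supported in `|x|₁ < ½L`,
`#{|x|₁ < ½L} ≤ 16L⁴`, `|Γ_1| ≤ c`, `|Γ_{j+1}| ≤ c/L^{2j}`).
[cite: BauerschmidtBrydgesSlade2015LogCorr, §5.1–§5.2 (finite range and scaling estimate)] -/
theorem abs_pairSum_one_le {L : ℝ} (hL : 2 ≤ L) {c : ℝ} (hc : 0 ≤ c)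
    (hG : ∀ L : ℝ, 2 ≤ L → ∀ s : ℝ, 0 ≤ s → ∀ i : ℕ, ∀ x : Site 4, |Gam 4 L s (i + 1) x| ≤ c / L ^ (2 * i))
    (j : ℕ) :
    |∑ x ∈ PT.ball (L ^ (j + 1) / 2), Gam 4 L 0 (0 + 1) x * Gam 4 L 0 (j + 1) x| ≤
      16 * c ^ 2 * L ^ 4 / L ^ (2 * j) := by
  have hL0 : (0 : ℝ) < L := by linarith
  have hL1 : (1 : ℝ) ≤ L := by linarith
  -- restrict to the range of `Γ_1`
  have hsub : ∑ x ∈ PT.ball (L ^ (j + 1) / 2), Gam 4 L 0 (0 + 1) x * Gam 4 L 0 (j + 1) x =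
      ∑ x ∈ PT.ball (L ^ (0 + 1) / 2), Gam 4 L 0 (0 + 1) x * Gam 4 L 0 (j + 1) x := by
    symm
    refine Finset.sum_subset (fun x hx => PT.mem_ball.2 (lt_of_lt_of_le (PT.mem_ball.1 hx) ?_))
      fun x _ hx => ?_
    · have : L ^ (0 + 1) ≤ L ^ (j + 1) := pow_le_pow_right₀ hL1 (by omega)
      exact div_le_div_of_nonneg_right this (by norm_num)
    · rw [PT.mem_ball, not_lt] at hx
      rw [Gam_eq_zero (by norm_num) hL0.le le_rfl (0 + 1) x hx, zero_mul]
  rw [hsub]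
  have hcard : ((PT.ball (d := 4) (L ^ (0 + 1) / 2)).card : ℝ) ≤ 16 * L ^ 4 := by
    have := card_ball_four_le hL1 0
    simpa using this
  have hpt : ∀ x : Site 4, |Gam 4 L 0 (0 + 1) x * Gam 4 L 0 (j + 1) x| ≤ c * (c / L ^ (2 * j)) := by
    intro x
    rw [abs_mul]
    have h1 := hG L hL 0 le_rfl 0 x
    rw [mul_zero, pow_zero, div_one] at h1
    exact mul_le_mul h1 (hG L hL 0 le_rfl j x) (abs_nonneg _) hc
  calc |∑ x ∈ PT.ball (L ^ (0 + 1) / 2), Gam 4 L 0 (0 + 1) x * Gam 4 L 0 (j + 1) x|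
      ≤ ∑ x ∈ PT.ball (L ^ (0 + 1) / 2), |Gam 4 L 0 (0 + 1) x * Gam 4 L 0 (j + 1) x| :=
        Finset.abs_sum_le_sum_abs _ _
    _ ≤ ∑ _x ∈ PT.ball (L ^ (0 + 1) / 2), c * (c / L ^ (2 * j)) := Finset.sum_le_sum fun x _ => hpt x
    _ = (PT.ball (d := 4) (L ^ (0 + 1) / 2)).card * (c * (c / L ^ (2 * j))) := by
        rw [Finset.sum_const, nsmul_eq_mul]
    _ ≤ 16 * L ^ 4 * (c * (c / L ^ (2 * j))) := mul_le_mul_of_nonneg_right hcard (by positivity)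
    _ = 16 * c ^ 2 * L ^ 4 / L ^ (2 * j) := by ring

/-! ### `β_j(0) = b̄_j + O(jL^{-j})` with `b̄_j = 8[J_0 + 2Σ_{l=1}^{j-1}L^{-2l}J_l]` -/

/-- **`b̄_j = 8[J_0 + 2Σ_{l=1}^{j-1}L^{-2l}J_l]`**, the scaling-limit approximation of `β_j(0)`.
[cite: BauerschmidtBrydgesSlade2015LogCorr, §6.1 ("lim_{j→∞}β_j … for m² = 0")] -/
def betaApprox (L : ℝ) (j : ℕ) : ℝ :=
  8 * (innerG0 4 L 0 + 2 * ∑ l ∈ Finset.Ico 1 j, (1 / L ^ 2) ^ l * innerG0 4 L l)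

/-- **`|β_j(0) - b̄_j| ≤ K(j+1)L^{-j}`** for `j ≥ 1`, `L ≥ 2` (the three kinds of pair sums).
[cite: BauerschmidtBrydgesSlade2015LogCorr, §6.1 ("it is shown in [BBS-rg-pt] that lim_{j→∞}β_j [exists] for m² = 0")] -/
theorem abs_betaPT_zero_sub_betaApprox_le {L : ℝ} (hL : 2 ≤ L) :
    ∃ K : ℝ, 0 < K ∧ ∀ j : ℕ, 1 ≤ j →
      |betaPT 4 L 0 j - betaApprox L j| ≤ K * ((j : ℝ) + 1) * (1 / L) ^ j := by
  have hL0 : (0 : ℝ) < L := by linarith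
  have hL1 : (1 : ℝ) ≤ L := by linarith
  obtain ⟨C, hC, hA⟩ := sum_Gam_mul_Gam_asymp (d := 4) (by norm_num) hL
  obtain ⟨c, hc, hG⟩ := abs_Gam_four_le
  refine ⟨8 * (3 * C + 32 * c ^ 2 * L ^ 4), by positivity, fun j hj => ?_⟩
  set r : ℝ := 1 / L with hr
  have hr0 : 0 < r := by rw [hr]; positivity
  have hr1 : r ≤ 1 := by rw [hr, div_le_one hL0]; exact hL1
  have hrL : ∀ n : ℕ, (L ^ n)⁻¹ = r ^ n := fun n => by rw [hr, one_div, inv_pow]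
  have hr2 : ∀ n : ℕ, (1 / L ^ 2) ^ n = r ^ n * r ^ n := fun n => by
    rw [hr, one_div, one_div, inv_pow, inv_pow, ← mul_inv, ← pow_mul, ← pow_add]
    ring_nf
  -- the pair-sum decomposition
  set S : ℕ → ℝ := fun i => ∑ x ∈ PT.ball (L ^ (j + 1) / 2), Gam 4 L 0 (i + 1) x * Gam 4 L 0 (j + 1) x
    with hS
  have hβ : betaPT 4 L 0 j = 8 * (S j + 2 * ∑ i ∈ range j, S i) := betaPT_zero_eq_pairSums hL1 j
  -- split off `i = 0`
  have hsplit : ∑ i ∈ range j, S i = S 0 + ∑ i ∈ Finset.Ico 1 j, S i := by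
    rw [Finset.range_eq_Ico, Finset.sum_eq_sum_Ico_succ_bot hj]
  -- the three estimates
  have htop : |S j - innerG0 4 L 0| ≤ C * r ^ (j + 1) := by
    rw [← hrL]; exact abs_pairSum_top_sub_le hL hA hj
  have hone : |S 0| ≤ 16 * c ^ 2 * L ^ 4 * (r ^ j * r ^ j) := by
    have := abs_pairSum_one_le hL hc.le hG j
    rw [hS]
    refine this.trans (le_of_eq ?_)
    rw [← hr2, one_div, inv_pow, ← pow_mul, div_eq_mul_inv]
  have hmid : ∀ i ∈ Finset.Ico 1 j, |S i - (1 / L ^ 2) ^ (j - i) * innerG0 4 L (j - i)| ≤ C * r ^ (j + 1) := by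
    intro i hi
    rw [Finset.mem_Ico] at hi
    have h := abs_pairSum_mid_sub_le hL hA hi.1 hi.2
    refine h.trans ?_
    rw [hrL, hr2]
    -- `r^{j-i}r^{j-i}r^{i+1} ≤ r^{j+1}`: drop one factor `r^{j-i} ≤ 1`
    have h1 : r ^ (j - i) ≤ 1 := pow_le_one₀ hr0.le hr1
    have h2 : r ^ (j - i) * r ^ (i + 1) = r ^ (j + 1) := by
      rw [← pow_add]; congr 1; omega
    calc C * (r ^ (j - i) * r ^ (j - i)) * r ^ (i + 1)
        = C * r ^ (j - i) * (r ^ (j - i) * r ^ (i + 1)) := by ring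
      _ = C * r ^ (j - i) * r ^ (j + 1) := by rw [h2]
      _ ≤ C * 1 * r ^ (j + 1) := by gcongr
      _ = C * r ^ (j + 1) := by ring
  -- assemble
  have hdiff : betaPT 4 L 0 j - betaApprox L j =
      8 * ((S j - innerG0 4 L 0) + 2 * S 0 +
        2 * ∑ i ∈ Finset.Ico 1 j, (S i - (1 / L ^ 2) ^ (j - i) * innerG0 4 L (j - i))) := by
    rw [hβ, hsplit]
    unfold betaApprox
    -- reflect the sum in `betaApprox`: `Σ_{l∈Ico 1 j} f l = Σ_{i∈Ico 1 j} f (j-i)`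
    have hrefl : ∑ l ∈ Finset.Ico 1 j, (1 / L ^ 2) ^ l * innerG0 4 L l =
        ∑ i ∈ Finset.Ico 1 j, (1 / L ^ 2) ^ (j - i) * innerG0 4 L (j - i) := by
      have := Finset.sum_Ico_reflect (fun l => (1 / L ^ 2) ^ l * innerG0 4 L l) 1 (m := j) (n := j)
        (Nat.le_succ j)
      rw [show j + 1 - j = 1 by omega, show j + 1 - 1 = j by omega] at this
      exact this.symm
    rw [hrefl, Finset.sum_sub_distrib]
    ring
  rw [hdiff, abs_mul, show |(8 : ℝ)| = 8 by norm_num]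
  have hsum : |∑ i ∈ Finset.Ico 1 j, (S i - (1 / L ^ 2) ^ (j - i) * innerG0 4 L (j - i))| ≤
      (j : ℝ) * (C * r ^ (j + 1)) := by
    refine (Finset.abs_sum_le_sum_abs _ _).trans ((Finset.sum_le_sum hmid).trans ?_)
    rw [Finset.sum_const, nsmul_eq_mul, Nat.card_Ico]
    have : ((j - 1 : ℕ) : ℝ) ≤ j := by exact_mod_cast Nat.sub_le j 1
    exact mul_le_mul_of_nonneg_right this (by positivity)
  have hrj : r ^ (j + 1) ≤ r ^ j := pow_le_pow_of_le_one hr0.le hr1 (Nat.le_succ j)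
  have hrjj : r ^ j * r ^ j ≤ r ^ j := mul_le_of_le_one_right (by positivity) (pow_le_one₀ hr0.le hr1)
  have hrpos : 0 ≤ r ^ j := by positivity
  calc 8 * |(S j - innerG0 4 L 0) + 2 * S 0 +
        2 * ∑ i ∈ Finset.Ico 1 j, (S i - (1 / L ^ 2) ^ (j - i) * innerG0 4 L (j - i))|
      ≤ 8 * (|S j - innerG0 4 L 0| + 2 * |S 0| +
        2 * |∑ i ∈ Finset.Ico 1 j, (S i - (1 / L ^ 2) ^ (j - i) * innerG0 4 L (j - i))|) := by
        refine mul_le_mul_of_nonneg_left ?_ (by norm_num)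
        refine (abs_add_le _ _).trans (add_le_add ((abs_add_le _ _).trans (add_le_add le_rfl ?_)) ?_)
        · rw [abs_mul, abs_two]
        · rw [abs_mul, abs_two]
    _ ≤ 8 * (C * r ^ (j + 1) + 2 * (16 * c ^ 2 * L ^ 4 * (r ^ j * r ^ j)) +
        2 * ((j : ℝ) * (C * r ^ (j + 1)))) := by
        gcongr
    _ ≤ 8 * (C * r ^ j + 2 * (16 * c ^ 2 * L ^ 4 * r ^ j) + 2 * ((j : ℝ) * (C * r ^ j))) := by
        have h1 : 16 * c ^ 2 * L ^ 4 * (r ^ j * r ^ j) ≤ 16 * c ^ 2 * L ^ 4 * r ^ j :=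
          mul_le_mul_of_nonneg_left hrjj (by positivity)
        have h2 : (j : ℝ) * (C * r ^ (j + 1)) ≤ (j : ℝ) * (C * r ^ j) :=
          mul_le_mul_of_nonneg_left (mul_le_mul_of_nonneg_left hrj hC.le) (Nat.cast_nonneg j)
        nlinarith [mul_le_mul_of_nonneg_left hrj hC.le]
    _ ≤ 8 * (3 * C + 32 * c ^ 2 * L ^ 4) * ((j : ℝ) + 1) * (1 / L) ^ j := by
        rw [← hr]
        have hj0 : (0 : ℝ) ≤ j := Nat.cast_nonneg j
        nlinarith [mul_nonneg hC.le hrpos, mul_nonneg (mul_nonneg hC.le hrpos) hj0,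
          mul_nonneg (by positivity : (0:ℝ) ≤ 32 * c ^ 2 * L ^ 4) hrpos,
          mul_nonneg (mul_nonneg (by positivity : (0:ℝ) ≤ 32 * c ^ 2 * L ^ 4) hrpos) hj0]

/-! ### The limit `b̄_L = 8[J_0 + 2Σ_{l≥1}L^{-2l}J_l] > 0` -/

/-- **`b̄_L = 8[2Σ_{l≥0}L^{-2l}J_l - J_0] = 8[J_0 + 2Σ_{l≥1}L^{-2l}J_l]`**, the limit of `β_j(0)`.
[cite: BauerschmidtBrydgesSlade2015LogCorr, §6.1 ("lim_{j→∞}β_j … for m² = 0")] -/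
def betaLim (L : ℝ) : ℝ :=
  8 * (2 * ∑' l : ℕ, (1 / L ^ 2) ^ l * innerG0 4 L l - innerG0 4 L 0)

/-- The series `Σ_lL^{-2l}J_l` converges absolutely (`|J_l| ≤ K`, `L ≥ 2`). [folklore] -/
theorem summable_innerG0_geometric {L : ℝ} (hL : 2 ≤ L) :
    Summable fun l : ℕ => (1 / L ^ 2) ^ l * innerG0 4 L l := by
  obtain ⟨K, hK, hb⟩ := abs_innerG0_le (d := 4) (by norm_num) hL
  have hq0 : (0 : ℝ) ≤ 1 / L ^ 2 := by positivity
  have hq1 : 1 / L ^ 2 < 1 := by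
    rw [div_lt_one (by positivity)]; nlinarith
  refine Summable.of_norm_bounded ((summable_geometric_of_lt_one hq0 hq1).mul_right K) fun l => ?_
  rw [Real.norm_eq_abs, abs_mul, abs_of_nonneg (pow_nonneg hq0 l)]
  exact mul_le_mul_of_nonneg_left (hb l) (pow_nonneg hq0 l)

/-- **`b̄_j → b̄_L`** as `j → ∞`. [cite: BauerschmidtBrydgesSlade2015LogCorr, §6.1 ("lim_{j→∞}β_j … for m² = 0")] -/
theorem tendsto_betaApprox {L : ℝ} (hL : 2 ≤ L) :
    Tendsto (fun j => betaApprox L j) atTop (𝓝 (betaLim L)) := by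
  have hsum := summable_innerG0_geometric hL
  have hT := hsum.hasSum.tendsto_sum_nat
  -- `b̄_j = 8(2Σ_{l<j}g_l - J_0)` for `j ≥ 1`
  have heq : ∀ᶠ j : ℕ in atTop, betaApprox L j =
      8 * (2 * ∑ l ∈ range j, (1 / L ^ 2) ^ l * innerG0 4 L l - innerG0 4 L 0) := by
    filter_upwards [eventually_ge_atTop 1] with j hj
    unfold betaApprox
    rw [Finset.range_eq_Ico, Finset.sum_eq_sum_Ico_succ_bot hj, pow_zero, one_mul]
    ring
  refine Tendsto.congr' (EventuallyEq.symm heq) ?_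
  unfold betaLim
  exact ((hT.const_mul 2).sub_const _).const_mul 8

/-- **`b̄_L ≥ 8J_0 > 0`** (`J_l ≥ 0`, `J_0 > 0`). [cite: BauerschmidtBrydgesSlade2015LogCorr, §6.1 ("β_j is bounded away from 0 for sufficiently large j")] -/
theorem betaLim_pos {L : ℝ} (hL : 2 ≤ L) : 0 < betaLim L := by
  have hsum := summable_innerG0_geometric hL
  have h0 := innerG0_zero_pos (d := 4) (by norm_num) hL
  have htail : 0 ≤ ∑' l : ℕ, (1 / L ^ 2) ^ (l + 1) * innerG0 4 L (l + 1) :=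
    tsum_nonneg fun l => mul_nonneg (by positivity) (innerG0_nonneg (d := 4) (by norm_num) hL (l + 1))
  unfold betaLim
  rw [hsum.tsum_eq_zero_add, pow_zero, one_mul]
  linarith

/-- **The critical `β_j` converge: `β_j(m² = 0) → b̄_L` as `j → ∞`** (`d = 4`, `L ≥ 2`), for the explicit
decomposition. [cite: BauerschmidtBrydgesSlade2015LogCorr, §6.1 ("Moreover, it is shown in [BBS-rg-pt] that lim_{j→∞}β_j … for m² = 0, so β_j is bounded away from 0 for sufficiently large j")] -/
theorem tendsto_betaPT_zero {L : ℝ} (hL : 2 ≤ L) :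
    Tendsto (fun j => betaPT 4 L 0 j) atTop (𝓝 (betaLim L)) := by
  have hL0 : (0 : ℝ) < L := by linarith
  obtain ⟨K, hK, hE⟩ := abs_betaPT_zero_sub_betaApprox_le hL
  have hr0 : (0 : ℝ) ≤ 1 / L := by positivity
  have hr1 : (1 : ℝ) / L < 1 := by rw [div_lt_one hL0]; linarith
  -- the error tends to `0`
  have herr : Tendsto (fun j : ℕ => K * ((j : ℝ) + 1) * (1 / L) ^ j) atTop (𝓝 0) := by
    have h1 := tendsto_self_mul_const_pow_of_lt_one hr0 hr1
    have h2 := tendsto_pow_atTop_nhds_zero_of_lt_one hr0 hr1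
    have : Tendsto (fun j : ℕ => K * ((j : ℝ) * (1 / L) ^ j + (1 / L) ^ j)) atTop (𝓝 (K * (0 + 0))) :=
      (h1.add h2).const_mul K
    rw [add_zero, mul_zero] at this
    refine this.congr fun j => ?_
    ring
  have hdiff : Tendsto (fun j => betaPT 4 L 0 j - betaApprox L j) atTop (𝓝 0) := by
    refine squeeze_zero_norm' ?_ herr
    filter_upwards [eventually_ge_atTop 1] with j hj
    rw [Real.norm_eq_abs]
    exact hE j hj
  have := (tendsto_betaApprox hL).add hdiff
  rw [add_zero] at this
  exact this.congr fun j => by ring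

/-- **BBS 2015, Assumption (A1), second clause, at the critical point `m² = 0`, PROVED for the explicit
decomposition in `d = 4`**: for every `L ≥ 2` there are `c = ½b̄_L > 0` and `j₀` with `β_j(0) ≥ c` for
all `j ≥ j₀` ("There exists `c > 0` such that `β_j ≥ c` for all but `c⁻¹` values of `j ≤ j_Ω`"; at
`m² = 0`, `j_Ω = ∞`, and the conclusion here is "all but finitely many `j`").
[cite: BauerschmidtBrydgesSlade2015LogCorr, §6.1, Assumption (A1) (second clause) and "β_j is bounded away from 0 for sufficiently large j"] -/
theorem BBS2015_A1_critical {L : ℝ} (hL : 2 ≤ L) :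
    ∃ c : ℝ, 0 < c ∧ ∃ j₀ : ℕ, ∀ j : ℕ, j₀ ≤ j → c ≤ betaPT 4 L 0 j := by
  have hb := betaLim_pos hL
  have hT := tendsto_betaPT_zero hL
  have hev : ∀ᶠ j in atTop, betaLim L / 2 < betaPT 4 L 0 j :=
    hT.eventually (lt_mem_nhds (by linarith))
  obtain ⟨j₀, hj₀⟩ := eventually_atTop.1 hev
  exact ⟨betaLim L / 2, by linarith, j₀, fun j hj => (hj₀ j hj).le⟩

end CTWSAW

end Literature.Barriers.CriticalPhenomena
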